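import Mathlib
import Summits.Ventures.PercRepro2.MergedUnionDefs

/-!
# The Gibbs chain on the merged cluster of `s` (blind cell PercRepro2, mine-1 g34)

The BHK06 §2 method, written as a finite-sum functional: one step of the chain explores the merged
cluster of `t` in `G ∖ W` (fresh configuration `ω`) and then the merged cluster of `s` in the
complement of the result (fresh configuration `ω'`):

  `step W ω ω' = merged (delConfig (merged (delConfig W ω) t Y X) ω') s X Y`,

and `iter n F W = E[F(W_n) | W_0 = W]` is the `n`-step expectation functional.  Three properties:

* **positive association is preserved** (`iter_mul_ge`): `iter n F · iter n G ≤ iter n (F G)` for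
  monotone `F, G` — Harris in each of the two half-steps (BHK06 Lemma 2.6), no four-function
  induction;
* **coalescence / contraction** (`iter_sub_abs_le`): if every edge at `t` is closed in `ω`, the
  explored cluster of `t` is `{t}` whatever `W`, so two chains driven by the same configurations
  coincide from that step on: `|iter n F W − iter n F W'| ≤ 2 M (1 − δ)^n`, `δ = P(all edges at t
  closed)`;
* **stationarity** (`expect_iter_mul_indicator`): the law of `S* = merged ω s X Y` under
  `P(· | t ∉ S*)` is invariant — the two tower identities of `MergedUnionDefs.lean`.

`MergedUnionPA.lean` combines the three (Archimedean limit) into the positive association of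
`(S*, T*)` under the union-conditioned pair law.
-/

namespace Summit.Ventures.PercRepro2

namespace MergedU

section Chain

variable {V : Type*} {E : Type*} [Fintype E] [DecidableEq E] [Fintype V] [DecidableEq V]
  {R : Type*} [Field R] [LinearOrder R] [IsStrictOrderedRing R]

/-- One step of the Gibbs chain: explore `T*` in `G ∖ W` with the configuration `ω`, then `S*`
in the complement of the result with the configuration `ω'`. -/
def step (ends : E → Sym2 V) (s t : V) (X Y : Set V) (W : Set V) (ω ω' : Config E) : Set V :=
  merged ends (delConfig ends (merged ends (delConfig ends W ω) t Y X) ω') s X Y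

/-- The `n`-step expectation functional of the chain: `iter n F W = E[F(W_n) | W_0 = W]`. -/
noncomputable def iter (p : E → R) (ends : E → Sym2 V) (s t : V) (X Y : Set V) :
    ℕ → (Set V → R) → Set V → R
  | 0, F, W => F W
  | n + 1, F, W => expect p (fun ω => expect p (fun ω' => iter p ends s t X Y n F
      (step ends s t X Y W ω ω')))

variable (p : E → R) (ends : E → Sym2 V) (s t : V) (X Y : Set V)

omit [Fintype V] [DecidableEq V] [LinearOrder R] [IsStrictOrderedRing R] in
/-- `iter 0`. -/
@[simp] lemma iter_zero (F : Set V → R) (W : Set V) : iter p ends s t X Y 0 F W = F W := rfl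

omit [Fintype V] [DecidableEq V] [LinearOrder R] [IsStrictOrderedRing R] in
/-- `iter (n+1)`. -/
lemma iter_succ (n : ℕ) (F : Set V → R) (W : Set V) :
    iter p ends s t X Y (n + 1) F W =
      expect p (fun ω => expect p (fun ω' => iter p ends s t X Y n F (step ends s t X Y W ω ω'))) :=
  rfl

omit [Fintype V] [DecidableEq V] [LinearOrder R] [IsStrictOrderedRing R] in
/-- `iter (n+1) F = iter 1 (iter n F)`. -/
lemma iter_succ_eq_iter_one (n : ℕ) (F : Set V → R) :
    iter p ends s t X Y (n + 1) F = iter p ends s t X Y 1 (iter p ends s t X Y n F) := rfl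

omit [Fintype E] [DecidableEq E] [Fintype V] [DecidableEq V] in
/-- `step` is monotone in the starting set. -/
lemma step_mono_W {W W' : Set V} (h : W ⊆ W') (ω ω' : Config E) :
    step ends s t X Y W ω ω' ⊆ step ends s t X Y W' ω ω' := by
  unfold step
  apply merged_mono
  apply delConfig_anti
  apply merged_mono
  exact delConfig_anti h ω

omit [Fintype E] [DecidableEq E] [Fintype V] [DecidableEq V] in
/-- `step` is antitone in the first configuration. -/
lemma step_anti_ω (W : Set V) {ω₁ ω₂ : Config E} (h : ω₁ ≤ ω₂) (ω' : Config E) :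
    step ends s t X Y W ω₂ ω' ⊆ step ends s t X Y W ω₁ ω' := by
  unfold step
  apply merged_mono
  apply delConfig_anti
  apply merged_mono
  exact delConfig_mono_config W h

omit [Fintype E] [DecidableEq E] [Fintype V] [DecidableEq V] in
/-- `step` is monotone in the second configuration. -/
lemma step_mono_ω' (W : Set V) (ω : Config E) {ω₁ ω₂ : Config E} (h : ω₁ ≤ ω₂) :
    step ends s t X Y W ω ω₁ ⊆ step ends s t X Y W ω ω₂ := by
  unfold step
  apply merged_mono
  exact delConfig_mono_config _ h

variable {p}

omit [Fintype V] [DecidableEq V] in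
/-- Expectations respect bounds from above. -/
lemma expect_le_of_le (hp : IsProbVec p) {f : Config E → R} {M : R} (h : ∀ ω, f ω ≤ M) :
    expect p f ≤ M := by
  have := expect_mono hp (g := fun _ => M) h
  rwa [expect_const] at this

omit [Fintype V] [DecidableEq V] in
/-- Expectations respect bounds from below. -/
lemma le_expect_of_le (hp : IsProbVec p) {f : Config E → R} {m : R} (h : ∀ ω, m ≤ f ω) :
    m ≤ expect p f := by
  have := expect_mono hp (f := fun _ => m) h
  rwa [expect_const] at this

omit [Fintype V] [DecidableEq V] in
/-- `|E f| ≤ E |f|`. -/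
lemma abs_expect_le (hp : IsProbVec p) (f : Config E → R) :
    |expect p f| ≤ expect p (fun ω => |f ω|) := by
  rw [abs_le]
  constructor
  · have h := expect_mono hp (f := fun ω => (-1 : R) * |f ω|) (g := f)
      (fun ω => by simp only [neg_one_mul]; exact neg_abs_le (f ω))
    rw [expect_const_mul] at h
    linarith
  · exact expect_mono hp fun ω => le_abs_self (f ω)

omit [Fintype V] [DecidableEq V] in
/-- Harris' inequality for two antitone observables. -/
lemma expect_mul_expect_le_expect_mul_anti (hp : IsProbVec p) {f g : Config E → R}
    (hf : Antitone f) (hg : Antitone g) :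
    expect p f * expect p g ≤ expect p (fun ω => f ω * g ω) := by
  have hf' : Monotone (fun ω => (-1 : R) * f ω) := fun ω ω' h => by
    have := hf h
    simp only
    linarith
  have hg' : Monotone (fun ω => (-1 : R) * g ω) := fun ω ω' h => by
    have := hg h
    simp only
    linarith
  have key := expect_mul_expect_le_expect_mul hp hf' hg'
  rw [expect_const_mul, expect_const_mul] at key
  have e : ((fun ω => (-1 : R) * f ω) * fun ω => (-1 : R) * g ω) = fun ω => f ω * g ω := by
    funext ω
    simp only [Pi.mul_apply]
    ring
  rw [e] at key
  linarith [key]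

/-! ## Monotonicity and bounds of `iter` -/

omit [Fintype V] [DecidableEq V] in
/-- `iter n F` is monotone for monotone `F`. -/
lemma iter_mono (hp : IsProbVec p) {F : Set V → R} (hF : Monotone F) (n : ℕ) :
    Monotone (iter p ends s t X Y n F) := by
  induction n with
  | zero => exact hF
  | succ n ih =>
    intro W W' h
    rw [iter_succ, iter_succ]
    refine expect_mono hp fun ω => expect_mono hp fun ω' => ?_
    exact ih (step_mono_W ends s t X Y h ω ω')

omit [Fintype V] [DecidableEq V] in
/-- `iter n F ≤ M` for `F ≤ M`. -/
lemma iter_le (hp : IsProbVec p) {F : Set V → R} {M : R} (hF : ∀ W, F W ≤ M) (n : ℕ) (W : Set V) :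
    iter p ends s t X Y n F W ≤ M := by
  induction n generalizing W with
  | zero => exact hF W
  | succ n ih =>
    rw [iter_succ]
    exact expect_le_of_le hp fun ω => expect_le_of_le hp fun ω' => ih _

omit [Fintype V] [DecidableEq V] in
/-- `m ≤ iter n F` for `m ≤ F`. -/
lemma le_iter (hp : IsProbVec p) {F : Set V → R} {m : R} (hF : ∀ W, m ≤ F W) (n : ℕ) (W : Set V) :
    m ≤ iter p ends s t X Y n F W := by
  induction n generalizing W with
  | zero => exact hF W
  | succ n ih =>
    rw [iter_succ]
    exact le_expect_of_le hp fun ω => le_expect_of_le hp fun ω' => ih _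

/-! ## Positive association is preserved by the chain -/

omit [Fintype V] [DecidableEq V] in
/-- **BHK06 Lemma 2.6 along the chain**: for monotone `F, G`,
`iter n F W · iter n G W ≤ iter n (F G) W`. -/
theorem iter_mul_ge (hp : IsProbVec p) {F G : Set V → R} (hF : Monotone F) (hG : Monotone G)
    (n : ℕ) (W : Set V) :
    iter p ends s t X Y n F W * iter p ends s t X Y n G W ≤
      iter p ends s t X Y n (fun W => F W * G W) W := by
  induction n generalizing W with
  | zero => exact le_rfl
  | succ n ih =>
    rw [iter_succ, iter_succ, iter_succ]
    -- inner expectations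
    set A : Config E → Config E → R := fun ω ω' =>
      iter p ends s t X Y n F (step ends s t X Y W ω ω') with hA
    set B : Config E → Config E → R := fun ω ω' =>
      iter p ends s t X Y n G (step ends s t X Y W ω ω') with hB
    have hAmono : ∀ ω, Monotone (A ω) := fun ω _ _ h =>
      iter_mono ends s t X Y hp hF n (step_mono_ω' ends s t X Y W ω h)
    have hBmono : ∀ ω, Monotone (B ω) := fun ω _ _ h =>
      iter_mono ends s t X Y hp hG n (step_mono_ω' ends s t X Y W ω h)
    have hAanti : Antitone (fun ω => expect p (A ω)) := fun _ _ h =>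
      expect_mono hp fun ω' =>
        iter_mono ends s t X Y hp hF n (step_anti_ω ends s t X Y W h ω')
    have hBanti : Antitone (fun ω => expect p (B ω)) := fun _ _ h =>
      expect_mono hp fun ω' =>
        iter_mono ends s t X Y hp hG n (step_anti_ω ends s t X Y W h ω')
    -- step 1: the induction hypothesis pointwise
    have h1 : expect p (fun ω => expect p (fun ω' => A ω ω' * B ω ω')) ≤
        expect p (fun ω => expect p (fun ω' =>
          iter p ends s t X Y n (fun W => F W * G W) (step ends s t X Y W ω ω'))) :=
      expect_mono hp fun ω => expect_mono hp fun ω' => ih _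
    -- step 2: Harris in `ω'`
    have h2 : expect p (fun ω => expect p (A ω) * expect p (B ω)) ≤
        expect p (fun ω => expect p (fun ω' => A ω ω' * B ω ω')) :=
      expect_mono hp fun ω => expect_mul_expect_le_expect_mul hp (hAmono ω) (hBmono ω)
    -- step 3: Harris in `ω` for the antitone pair
    have h3 : expect p (fun ω => expect p (A ω)) * expect p (fun ω => expect p (B ω)) ≤
        expect p (fun ω => expect p (A ω) * expect p (B ω)) :=
      expect_mul_expect_le_expect_mul_anti hp hAanti hBanti
    exact h3.trans (h2.trans h1)

/-! ## Coalescence and contraction -/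

omit [Fintype V] [DecidableEq V] [Field R] [LinearOrder R] [IsStrictOrderedRing R] in
/-- The edges at `t`, as a finset. -/
noncomputable def tEdges (ends : E → Sym2 V) (t : V) : Finset E :=
  @Finset.filter E (fun e => e ∈ touches ends {t}) (Classical.decPred _) Finset.univ

omit [DecidableEq E] [Fintype V] [DecidableEq V] [Field R] [LinearOrder R]
  [IsStrictOrderedRing R] in
/-- Membership in `tEdges`. -/
lemma mem_tEdges {e : E} : e ∈ tEdges ends t ↔ e ∈ touches ends {t} := by
  unfold tEdges
  rw [@Finset.mem_filter E (fun e => e ∈ touches ends {t}) (Classical.decPred _) Finset.univ e]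
  simp

omit [Fintype E] [DecidableEq E] [Fintype V] [DecidableEq V] in
/-- **Coalescence**: if every edge at `t` is closed in `ω` (and `t ∉ Y`), `step W ω ω'` does not
depend on `W`. -/
lemma step_eq_of_allClosed {ω : Config E} (hω : ∀ e ∈ touches ends {t}, ω e = false)
    (htY : t ∉ Y) (W W' : Set V) (ω' : Config E) :
    step ends s t X Y W ω ω' = step ends s t X Y W' ω ω' := by
  unfold step
  rw [merged_eq_singleton_of_allClosed (allClosed_delConfig hω W) htY,
    merged_eq_singleton_of_allClosed (allClosed_delConfig hω W') htY]

omit [Fintype V] [DecidableEq V] [LinearOrder R] [IsStrictOrderedRing R] in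
/-- `P(all edges at t closed) = ∏ (1 - p e)` over the edges at `t`. -/
lemma prob_allClosed_tEdges :
    prob p (allClosed (tEdges ends t)) = ∏ e ∈ tEdges ends t, (1 - p e) :=
  prob_allClosed p _

omit [Fintype V] [DecidableEq V] in
/-- **Contraction**: two chains driven by the same configurations from different starts differ by
at most `2 M (1 − δ)^n`, `δ = P(all edges at t closed)`. -/
theorem iter_sub_abs_le (hp : IsProbVec p) (htY : t ∉ Y) {F : Set V → R} {M : R}
    (hF : ∀ W, |F W| ≤ M) (n : ℕ) (W W' : Set V) :
    |iter p ends s t X Y n F W - iter p ends s t X Y n F W'| ≤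
      2 * M * (1 - prob p (allClosed (tEdges ends t))) ^ n := by
  have hM : 0 ≤ M := (abs_nonneg _).trans (hF W)
  induction n generalizing W W' with
  | zero =>
    simp only [iter_zero, pow_zero, mul_one]
    calc |F W - F W'| ≤ |F W| + |F W'| := abs_sub _ _
      _ ≤ M + M := add_le_add (hF W) (hF W')
      _ = 2 * M := by ring
  | succ n ih =>
    rw [iter_succ, iter_succ, ← expect_sub]
    set q := 1 - prob p (allClosed (tEdges ends t)) with hq
    -- the inner difference
    set D : Config E → R := fun ω =>
      expect p (fun ω' => iter p ends s t X Y n F (step ends s t X Y W ω ω')) -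
      expect p (fun ω' => iter p ends s t X Y n F (step ends s t X Y W' ω ω')) with hD
    have hDbound : ∀ ω, |D ω| ≤ 2 * M * q ^ n := by
      intro ω
      simp only [hD]
      rw [← expect_sub]
      refine (abs_expect_le hp _).trans ?_
      refine expect_le_of_le hp fun ω' => ?_
      exact ih _ _
    have hDzero : ∀ ω ∈ allClosed (tEdges ends t), D ω = 0 := by
      intro ω hω
      have hω' : ∀ e ∈ touches ends {t}, ω e = false := fun e he =>
        hω e ((mem_tEdges ends t).2 he)
      simp only [hD]
      rw [sub_eq_zero]
      congr 1
      funext ω'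
      rw [step_eq_of_allClosed ends s t X Y hω' htY W W' ω']
    have hpt : ∀ ω, |D ω| ≤ 2 * M * q ^ n * ((allClosed (tEdges ends t))ᶜ).indicator 1 ω := by
      intro ω
      by_cases hω : ω ∈ allClosed (tEdges ends t)
      · rw [hDzero ω hω, Set.indicator_of_notMem (show ω ∉ (allClosed (tEdges ends t))ᶜ from
          fun h => h hω)]
        simp
      · rw [Set.indicator_of_mem (show ω ∈ (allClosed (tEdges ends t))ᶜ from hω)]
        simp only [Pi.one_apply, mul_one]
        exact hDbound ω
    change |expect p D| ≤ 2 * M * q ^ (n + 1)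
    refine (abs_expect_le hp D).trans ?_
    refine (expect_mono hp hpt).trans ?_
    rw [expect_const_mul, ← prob_eq_expect_indicator, prob_compl, ← hq, pow_succ]
    exact le_of_eq (by ring)

/-! ## Stationarity -/

omit [DecidableEq V] [LinearOrder R] [IsStrictOrderedRing R] in
/-- **One-step stationarity**: the law of `S*` under `P(· | t ∉ S*)` is invariant under one step
of the chain (the two tower identities). -/
theorem expect_iter_one_mul_indicator (G : Set V → R) :
    expect p (fun ω => iter p ends s t X Y 1 G (merged ends ω s X Y) *
        ({ω : Config E | t ∉ merged ends ω s X Y}).indicator 1 ω) =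
      expect p (fun ω => G (merged ends ω s X Y) *
        ({ω : Config E | t ∉ merged ends ω s X Y}).indicator 1 ω) := by
  -- (T1): explore `S*`, then the fresh `T*`
  have h1 := expect_merged_mul_indicator p ends s t X Y
    (fun W D => expect p (fun ω₂ => G (merged ends (delConfig ends D ω₂) s X Y)))
  -- (T2): explore `T*`, then the fresh `S*` (the tower identity with the roles of `s` and `t`
  -- exchanged)
  have h2 := expect_merged_mul_indicator p ends t s Y X (fun _ W => G W)
  have hQ : ({ω : Config E | s ∉ merged ends ω t Y X} : Set (Config E)) =
      {ω : Config E | t ∉ merged ends ω s X Y} := by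
    ext ω
    exact (notMem_merged_iff ω s t X Y).symm
  rw [hQ] at h2
  have e1 : (fun ω => iter p ends s t X Y 1 G (merged ends ω s X Y) *
      ({ω : Config E | t ∉ merged ends ω s X Y}).indicator (1 : Config E → R) ω) =
      fun ω => expect p (fun ω' => (fun W D => expect p
        (fun ω₂ => G (merged ends (delConfig ends D ω₂) s X Y))) (merged ends ω s X Y)
        (merged ends (delConfig ends (merged ends ω s X Y) ω') t Y X)) *
        ({ω : Config E | t ∉ merged ends ω s X Y}).indicator 1 ω := by
    funext ω
    rfl
  rw [e1, ← h1]
  exact h2.symm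

omit [DecidableEq V] [LinearOrder R] [IsStrictOrderedRing R] in
/-- **Stationarity**: `E[iter n F (S*) 1_Q] = E[F(S*) 1_Q]`, `Q = {t ∉ S*}`. -/
theorem expect_iter_mul_indicator (n : ℕ) (F : Set V → R) :
    expect p (fun ω => iter p ends s t X Y n F (merged ends ω s X Y) *
        ({ω : Config E | t ∉ merged ends ω s X Y}).indicator 1 ω) =
      expect p (fun ω => F (merged ends ω s X Y) *
        ({ω : Config E | t ∉ merged ends ω s X Y}).indicator 1 ω) := by
  induction n with
  | zero => rfl
  | succ n ih =>
    rw [iter_succ_eq_iter_one, expect_iter_one_mul_indicator, ih]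

end Chain

end MergedU

end Summit.Ventures.PercRepro2
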